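import Mathlib

/-!
# No analytic anomaly (Coleman–Grossman at zero momentum)

Stub `stub_noAnalyticAnomaly` of the line `Sketch` (infimum descent) for the crux
`SpectralDefectExtinction.ChiralDescent`.

A three-index vertex function `Γ(p,q)_{μνλ}` on `ℝ⁴ × ℝ⁴` that is differentiable at the origin and
exactly transverse in its first index against `p` and in its second index against `q` (the two
vector Ward identities, no contact terms) cannot carry an anomaly term `c · det[e_μ, e_ν, p, q]`
with `c ≠ 0` in its axial contraction minus the two one-momentum slices, at order `‖(p,q)‖²`.

The proof is pure finite-dimensional calculus.  Restrict to the curve `t ↦ (t e_α, t e_β)` with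
`{μ, ν, α, β} = Fin 4` (obtained from a permutation `σ` of `Fin 4` with `σ 0 = μ`, `σ 1 = ν`).
Differentiability at `0` makes every mixed second difference
`Γ(t u + t v) - Γ(t u) - Γ(t v) + Γ 0` an `o(t)`; the Ward identities along coordinate rays kill
the remaining first-order terms, so the three `Γ`-sums of the hypothesis are `o(t²)` along the
curve, while the determinant there is `sign σ · t²`.  Hence `c · sign σ · t² = o(t²)`, so `c = 0`.
-/

namespace Summit.QuantumFields.QCD.Cruxes.ChiralDescent.InfimumDescent

open Filter Topology Asymptotics

/-- Mixed second differences of a map differentiable at `0` are `o(t)` along pairs of rays: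
`Γ(t(u+v)) - Γ(tu) - Γ(tv) + Γ(0) = o(t)` as `t → 0`. -/
private theorem mixed_difference_isLittleO {E F : Type*} [NormedAddCommGroup E] [NormedSpace ℝ E]
    [NormedAddCommGroup F] [NormedSpace ℝ F] {Γ : E → F} (hΓ : DifferentiableAt ℝ Γ 0) (u v : E) :
    (fun t : ℝ => Γ (t • (u + v)) - Γ (t • u) - Γ (t • v) + Γ 0) =o[𝓝 0] fun t => t := by
  have key : ∀ w : E,
      (fun t : ℝ => Γ (t • w) - Γ 0 - t • fderiv ℝ Γ 0 w) =o[𝓝 0] fun t => t := by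
    intro w
    have h1 : HasDerivAt (Γ ∘ fun t : ℝ => t • w) (fderiv ℝ Γ 0 ((1 : ℝ) • w)) 0 :=
      hΓ.hasFDerivAt.comp_hasDerivAt_of_eq 0 ((hasDerivAt_id' (0 : ℝ)).smul_const w)
        (by simp)
    have h2 := h1.isLittleO
    simp only [Function.comp_apply, zero_smul, sub_zero, one_smul] at h2
    exact h2
  refine (((key (u + v)).sub (key u)).sub (key v)).congr_left fun t => ?_
  simp only [map_add, smul_add]
  abel

/-- Component form of `mixed_difference_isLittleO` on the product space `ℝ⁴ × ℝ⁴`, along the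
rays spanned by `(p, 0)` and `(0, q)`. -/
private theorem mixed_difference_apply
    {Γ : (Fin 4 → ℝ) × (Fin 4 → ℝ) → Fin 4 → Fin 4 → Fin 4 → ℝ} (hΓ : DifferentiableAt ℝ Γ 0)
    (p q : Fin 4 → ℝ) (i j k : Fin 4) :
    (fun t : ℝ => Γ (t • p, t • q) i j k - Γ (t • p, 0) i j k - Γ (0, t • q) i j k + Γ 0 i j k)
      =o[𝓝 0] fun t => t := by
  have h := mixed_difference_isLittleO hΓ (p, 0) (0, q)
  simp only [Prod.mk_add_mk, add_zero, zero_add, Prod.smul_mk, smul_zero] at h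
  refine IsBigO.trans_isLittleO (isBigO_of_le _ fun t => ?_) h
  change ‖(Γ (t • p, t • q) - Γ (t • p, 0) - Γ (0, t • q) + Γ 0) i j k‖ ≤ _
  exact (norm_le_pi_norm _ k).trans ((norm_le_pi_norm _ j).trans (norm_le_pi_norm _ i))

/-- The analytic core: if `det[e_μ, e_ν, t e_α, t e_β] = D t²` with `D ≠ 0`, then the hypothesis of
`stub_noAnalyticAnomaly` restricted to the curve `t ↦ (t e_α, t e_β)` forces `c = 0`. -/
private theorem eq_zero_of_curve
    (Γ : (Fin 4 → ℝ) × (Fin 4 → ℝ) → Fin 4 → Fin 4 → Fin 4 → ℝ) (hΓ : DifferentiableAt ℝ Γ 0)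
    (hV₁ : ∀ (p q : Fin 4 → ℝ) (ν l : Fin 4), ∑ μ, p μ * Γ (p, q) μ ν l = 0)
    (hV₂ : ∀ (p q : Fin 4 → ℝ) (μ l : Fin 4), ∑ ν, q ν * Γ (p, q) μ ν l = 0)
    (c : ℝ) (μ ν α β : Fin 4) (D : ℝ) (hD : D ≠ 0)
    (hdet : ∀ t : ℝ, (Matrix.of ![(Pi.single μ 1 : Fin 4 → ℝ), Pi.single ν 1,
      t • (Pi.single α 1 : Fin 4 → ℝ), t • (Pi.single β 1 : Fin 4 → ℝ)]).det = D * t ^ 2)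
    (hA : (fun pq : (Fin 4 → ℝ) × (Fin 4 → ℝ) =>
        (∑ l, (pq.1 l + pq.2 l) * Γ pq μ ν l) - (∑ l, pq.1 l * Γ (pq.1, 0) μ ν l) -
          (∑ l, pq.2 l * Γ (0, pq.2) μ ν l) -
          c * (Matrix.of ![(Pi.single μ 1 : Fin 4 → ℝ), Pi.single ν 1, pq.1, pq.2]).det) =o[𝓝 0]
      (fun pq : (Fin 4 → ℝ) × (Fin 4 → ℝ) => ‖pq‖ ^ 2)) :
    c = 0 := by
  -- the Ward identities along the coordinate rays `s e_μ` and `s e_ν`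
  have hW1 : ∀ (s : ℝ) (q : Fin 4 → ℝ) (j k : Fin 4), s ≠ 0 →
      Γ (s • (Pi.single μ 1 : Fin 4 → ℝ), q) μ j k = 0 := by
    intro s q j k hs
    have h := hV₁ (s • Pi.single μ 1) q j k
    rw [Finset.sum_eq_single μ (fun b _ hb => by simp [hb])
      (fun h => (h (Finset.mem_univ μ)).elim)] at h
    simpa [hs] using h
  have hW2 : ∀ (s : ℝ) (p : Fin 4 → ℝ) (i k : Fin 4), s ≠ 0 →
      Γ (p, s • (Pi.single ν 1 : Fin 4 → ℝ)) i ν k = 0 := by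
    intro s p i k hs
    have h := hV₂ p (s • Pi.single ν 1) i k
    rw [Finset.sum_eq_single ν (fun b _ hb => by simp [hb])
      (fun h => (h (Finset.mem_univ ν)).elim)] at h
    simpa [hs] using h
  -- first-order terms killed by the Ward identities
  have ha : (fun t : ℝ => Γ (0, t • (Pi.single β 1 : Fin 4 → ℝ)) μ ν α - Γ 0 μ ν α)
      =o[𝓝 0] fun t => t := by
    refine (mixed_difference_apply hΓ (Pi.single μ 1) (Pi.single β 1) μ ν α).neg_left.congr_left
      fun t => ?_
    rcases eq_or_ne t 0 with rfl | ht
    · simp only [zero_smul]; ring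
    · rw [hW1 t _ ν α ht, hW1 t _ ν α ht]; ring
  have hb : (fun t : ℝ => Γ (t • (Pi.single α 1 : Fin 4 → ℝ), 0) μ ν β - Γ 0 μ ν β)
      =o[𝓝 0] fun t => t := by
    refine (mixed_difference_apply hΓ (Pi.single α 1) (Pi.single ν 1) μ ν β).neg_left.congr_left
      fun t => ?_
    rcases eq_or_ne t 0 with rfl | ht
    · simp only [zero_smul]; ring
    · rw [hW2 t _ μ β ht, hW2 t _ μ β ht]; ring
  -- the normalised axial combination along the curve is `o(t)`
  have hN : (fun t : ℝ =>
      Γ (t • (Pi.single α 1 : Fin 4 → ℝ), t • (Pi.single β 1 : Fin 4 → ℝ)) μ ν α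
        + Γ (t • (Pi.single α 1 : Fin 4 → ℝ), t • (Pi.single β 1 : Fin 4 → ℝ)) μ ν β
        - Γ (t • (Pi.single α 1 : Fin 4 → ℝ), 0) μ ν α
        - Γ (0, t • (Pi.single β 1 : Fin 4 → ℝ)) μ ν β) =o[𝓝 0] fun t => t := by
    refine (((mixed_difference_apply hΓ (Pi.single α 1) (Pi.single β 1) μ ν α).add ha).add
      ((mixed_difference_apply hΓ (Pi.single α 1) (Pi.single β 1) μ ν β).add hb)).congr_left
      fun t => ?_
    ring
  -- restrict the hypothesis to the curve `t ↦ (t e_α, t e_β)`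
  have hφ : Tendsto (fun t : ℝ =>
      ((t • (Pi.single α 1 : Fin 4 → ℝ), t • (Pi.single β 1 : Fin 4 → ℝ)) :
        (Fin 4 → ℝ) × (Fin 4 → ℝ))) (𝓝 0) (𝓝 0) := by
    have hc : Continuous (fun t : ℝ =>
        ((t • (Pi.single α 1 : Fin 4 → ℝ), t • (Pi.single β 1 : Fin 4 → ℝ)) :
          (Fin 4 → ℝ) × (Fin 4 → ℝ))) := by fun_prop
    have h := hc.tendsto 0
    rwa [zero_smul, zero_smul, Prod.mk_zero_zero] at h
  have hsum : ∀ (i : Fin 4) (s : ℝ) (X : Fin 4 → ℝ),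
      ∑ l, (s • (Pi.single i (1 : ℝ) : Fin 4 → ℝ)) l * X l = s * X i := by
    intro i s X
    rw [Finset.sum_eq_single i (fun b _ hb => by simp [hb])
      (fun h => (h (Finset.mem_univ i)).elim)]
    simp
  have hnorm : ((fun pq : (Fin 4 → ℝ) × (Fin 4 → ℝ) => ‖pq‖ ^ 2) ∘ (fun t : ℝ =>
      ((t • (Pi.single α 1 : Fin 4 → ℝ), t • (Pi.single β 1 : Fin 4 → ℝ)) :
        (Fin 4 → ℝ) × (Fin 4 → ℝ)))) = fun t => t ^ 2 := by
    funext t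
    simp [norm_smul, Pi.norm_single]
  have h3 : (fun t : ℝ => t *
      (Γ (t • (Pi.single α 1 : Fin 4 → ℝ), t • (Pi.single β 1 : Fin 4 → ℝ)) μ ν α
        + Γ (t • (Pi.single α 1 : Fin 4 → ℝ), t • (Pi.single β 1 : Fin 4 → ℝ)) μ ν β
        - Γ (t • (Pi.single α 1 : Fin 4 → ℝ), 0) μ ν α
        - Γ (0, t • (Pi.single β 1 : Fin 4 → ℝ)) μ ν β) - c * (D * t ^ 2))
      =o[𝓝 0] fun t => t ^ 2 := by
    have h := hA.comp_tendsto hφ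
    rw [hnorm] at h
    refine h.congr_left fun t => ?_
    simp only [Function.comp_apply, add_mul, Finset.sum_add_distrib, hsum, hdet]
    ring
  have h4 : (fun t : ℝ => c * D * t ^ 2) =o[𝓝 0] fun t => t ^ 2 := by
    have h5 : (fun t : ℝ => t *
        (Γ (t • (Pi.single α 1 : Fin 4 → ℝ), t • (Pi.single β 1 : Fin 4 → ℝ)) μ ν α
          + Γ (t • (Pi.single α 1 : Fin 4 → ℝ), t • (Pi.single β 1 : Fin 4 → ℝ)) μ ν β
          - Γ (t • (Pi.single α 1 : Fin 4 → ℝ), 0) μ ν α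
          - Γ (0, t • (Pi.single β 1 : Fin 4 → ℝ)) μ ν β))
        =o[𝓝 0] fun t => t ^ 2 :=
      ((isBigO_refl (fun t : ℝ => t) (𝓝 0)).mul_isLittleO hN).congr_right fun t => (sq t).symm
    refine (h5.sub h3).congr_left fun t => ?_
    ring
  -- conclude: `t² = o(t²)` is absurd
  by_contra hc
  have h6 : (fun t : ℝ => t ^ 2) =o[𝓝 0] fun t => t ^ 2 :=
    (isLittleO_const_mul_left_iff (mul_ne_zero hc hD)).1 h4
  refine isLittleO_irrefl ?_ h6
  have h7 : ∀ᶠ t in 𝓝[≠] (0 : ℝ), t ^ 2 ≠ 0 :=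
    (eventually_mem_nhdsWithin : ∀ᶠ t in 𝓝[≠] (0 : ℝ), t ∈ ({0} : Set ℝ)ᶜ).mono fun t ht =>
      pow_ne_zero 2 ht
  exact h7.frequently.filter_mono nhdsWithin_le_nhds

/-- For `μ ≠ ν` in `Fin 4` there are indices `α, β` (completing `μ, ν` to a permutation `σ` of
`Fin 4`) for which `det[e_μ, e_ν, t e_α, t e_β] = sign σ · t²` for every `t`. -/
private theorem exists_det_eq (μ ν : Fin 4) (h : μ ≠ ν) :
    ∃ (α β : Fin 4) (D : ℝ), D ≠ 0 ∧ ∀ t : ℝ,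
      (Matrix.of ![(Pi.single μ 1 : Fin 4 → ℝ), Pi.single ν 1,
        t • (Pi.single α 1 : Fin 4 → ℝ), t • (Pi.single β 1 : Fin 4 → ℝ)]).det = D * t ^ 2 := by
  -- a permutation `σ` with `σ 0 = μ`, `σ 1 = ν`
  obtain ⟨σ, h0, h1⟩ : ∃ σ : Equiv.Perm (Fin 4), σ 0 = μ ∧ σ 1 = ν := by
    have hν : Equiv.swap 0 μ ν ≠ 0 := fun h' =>
      h ((Equiv.swap 0 μ).injective (h'.trans (Equiv.swap_apply_right 0 μ).symm)).symm
    refine ⟨Equiv.swap 0 μ * Equiv.swap 1 (Equiv.swap 0 μ ν), ?_, ?_⟩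
    · rw [Equiv.Perm.mul_apply, Equiv.swap_apply_of_ne_of_ne (by decide) hν.symm,
        Equiv.swap_apply_left]
    · rw [Equiv.Perm.mul_apply, Equiv.swap_apply_left, Equiv.swap_apply_self]
  refine ⟨σ 2, σ 3, ((Equiv.Perm.sign σ : ℤ) : ℝ), Int.cast_ne_zero.2 (Units.ne_zero _),
    fun t => ?_⟩
  have hM : Matrix.of ![(Pi.single μ 1 : Fin 4 → ℝ), Pi.single ν 1,
        t • (Pi.single (σ 2) 1 : Fin 4 → ℝ), t • (Pi.single (σ 3) 1 : Fin 4 → ℝ)] =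
      Matrix.of (fun i j => ![(1 : ℝ), 1, t, t] i *
        ((1 : Matrix (Fin 4) (Fin 4) ℝ).submatrix σ id) i j) := by
    ext i j
    rw [← h0, ← h1]
    fin_cases i <;> simp [Matrix.one_eq_pi_single]
  rw [hM, Matrix.det_mul_column, Matrix.det_permute, Matrix.det_one]
  simp [Fin.prod_univ_four]
  ring

/-- **No analytic anomaly** (Coleman–Grossman at zero momentum; pure analysis). A three-index
vertex function `Γ(p,q)_{μνλ}` on `ℝ⁴ × ℝ⁴`, differentiable at the origin and exactly transverse in
its first index against `p` and in its second index against `q` (the two vector Ward identities,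
for all momenta, no contact terms), cannot carry an anomaly: if its axial contraction
`(p+q)_λ Γ(p,q)_{μνλ}` minus the two one-momentum slices equals `c · det[e_μ, e_ν, p, q] + o(‖(p,q)‖²)`
near `0` with `μ ≠ ν`, then `c = 0`.  (Differentiability and the Ward identities give
`Γ(0) = 0`-type cancellations and `DΓ(0) = 0` on the relevant components, so the `Γ`-terms are
`o(‖(p,q)‖²)` along `p = t e_α`, `q = t e_β` with `{μ,ν,α,β} = Fin 4`, where the determinant is `± t²`.) -/
theorem stub_noAnalyticAnomaly :
    ∀ (Γ : (Fin 4 → ℝ) × (Fin 4 → ℝ) → Fin 4 → Fin 4 → Fin 4 → ℝ), DifferentiableAt ℝ Γ 0 →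
      (∀ (p q : Fin 4 → ℝ) (ν l : Fin 4), ∑ μ, p μ * Γ (p, q) μ ν l = 0) →
      (∀ (p q : Fin 4 → ℝ) (μ l : Fin 4), ∑ ν, q ν * Γ (p, q) μ ν l = 0) →
      ∀ (c : ℝ) (μ ν : Fin 4), μ ≠ ν →
        (fun pq : (Fin 4 → ℝ) × (Fin 4 → ℝ) =>
            (∑ l, (pq.1 l + pq.2 l) * Γ pq μ ν l) - (∑ l, pq.1 l * Γ (pq.1, 0) μ ν l) -
              (∑ l, pq.2 l * Γ (0, pq.2) μ ν l) -
              c * (Matrix.of ![(Pi.single μ 1 : Fin 4 → ℝ), Pi.single ν 1, pq.1, pq.2]).det) =o[𝓝 0]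
          (fun pq : (Fin 4 → ℝ) × (Fin 4 → ℝ) => ‖pq‖ ^ 2) →
        c = 0 := by
  intro Γ hΓ hV₁ hV₂ c μ ν hμν hA
  obtain ⟨α, β, D, hD, hdet⟩ := exists_det_eq μ ν hμν
  exact eq_zero_of_curve Γ hΓ hV₁ hV₂ c μ ν α β D hD hdet hA

end Summit.QuantumFields.QCD.Cruxes.ChiralDescent.InfimumDescent
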